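import Summits.CriticalPhenomena.CardyFormulaZ2.Theorems.CardyUSTContinuationKirchhoffExtremalLengthG02Dual3
import Summits.CriticalPhenomena.CardyFormulaZ2.Theorems.CardyUSTContinuationKirchhoffExtremalLengthG02Dual4

/-!
# A local bound for the conjugate near boundary points, I: boundary rings and good lines
# ([GP19] §3.2 local form, for the `meshDomain` / `discreteArc` discretisation)

Support file for `KirchhoffExtremalLength` (route CardyUSTContinuation of `CardyFormulaZ2`, item
stmt-CriticalPhenomena-11234), towards the upper half of `G02ModulusConvergence` (`…Defs.lean`).
Transposition of the first part of §D6 of the tree's `SquareTilingConjugate.lean` to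
`Ω_δ = discreteDomainGraph Ω δ`:

* `abs_facePot_sub_le_of_ring`: on the boundary ring of a rectangle met by the complement of
  the face component, `|facePot - c| ≤ 1 + Σ_ring |d facePot|` when the exits along the ring have
  the common virtual value `c`;
* `sum_ecur_sq_le_energy`, `exists_good_row'`, `exists_good_col'`: good rows and columns by
  length–area.
-/

noncomputable section

namespace Summit.CriticalPhenomena.CardyFormulaZ2.Theorems

namespace KirchhoffSlope

open Set Metric Filter Topology SimpleGraph
open Literature.Probability Literature.Probability.LatticeModels Literature.Probability.Percolation
open Literature.Probability.LatticeModels.SquareTiling (stepFlux walkFlux rectRing rectRing_add_period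
  rectRing_mod rectRing_adj exists_rectRing_eq rectRing_mem sum_range_shift_of_periodic sum_rectRing_eq
  exists_mem_support_on_rectBoundary sum_range_shift_le)
open Literature.Probability.RandomPlanarGeometry

variable {Ω : Set ℂ} {δ : ℝ}

open WeakBeurling

open Classical in
/-- **Bound for the conjugate on the boundary ring of a rectangle.** Let `c` be the common
virtual value of the exits met along the ring (forward direction), and suppose some square of
the ring is not in the component. Then at every square of the component on the ring,
`|h' - c| ≤ 1 + Σ_ring |dh'|`: walk along the ring up to the first exit (where `h' = c ∓ i`,
`|i| ≤ 1`), telescoping the CR-increments. [folklore] -/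
theorem abs_facePot_sub_le_of_ring (R : ConformalRectangle) (hδ : 0 < δ) {h : Site 2 → ℝ} {T B : Set (Site 2)}
    (hT : T ⊆ meshBoundary R.carrier δ) (hB : B ⊆ meshBoundary R.carrier δ)
    (hharm : ∀ x, x ∉ T → x ∉ B →
      ∑ y ∈ ((zdGraph 2).neighborFinset x).filter (fun y => (discreteDomainGraph R.carrier δ).Adj x y), (h y - h x) = 0)
    (h01 : ∀ x, h x ∈ Icc (0 : ℝ) 1) {p₀ : Site 2} (hp₀ : IsInnerFace R.carrier δ p₀) {c : ℝ} {xl xr yb yt : ℤ}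
    (hx : xl < xr) (hy : yb < yt)
    (hexit : ∀ k, (faceGraph R.carrier δ).Reachable p₀ (rectRing xl xr yb yt k) →
      ¬ (faceGraph R.carrier δ).Reachable p₀ (rectRing xl xr yb yt (k + 1)) →
      faceExitVal R.carrier δ h p₀ (rectRing xl xr yb yt k) (rectRing xl xr yb yt (k + 1)) = c)
    {k₁ : ℕ} (hout : ¬ (faceGraph R.carrier δ).Reachable p₀ (rectRing xl xr yb yt k₁))
    {k₀ : ℕ} (hp : (faceGraph R.carrier δ).Reachable p₀ (rectRing xl xr yb yt k₀)) :
    |facePot R.carrier δ h p₀ (rectRing xl xr yb yt k₀) - c| ≤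
      1 + ∑ l ∈ Finset.range (2 * (xr - xl).toNat + 2 * (yt - yb).toNat),
        |stepFlux (ecurH R.carrier δ h) (ecurV R.carrier δ h) (rectRing xl xr yb yt l) (rectRing xl xr yb yt (l + 1))| := by
  set P := 2 * (xr - xl).toNat + 2 * (yt - yb).toNat with hP
  have hP0 : 0 < P := by rw [hP]; omega
  set ring := rectRing xl xr yb yt with hring
  set F : Set (Site 2) := {q | (faceGraph R.carrier δ).Reachable p₀ q} with hF
  set f : ℕ → ℝ := fun l => |stepFlux (ecurH R.carrier δ h) (ecurV R.carrier δ h) (ring l) (ring (l + 1))| with hf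
  have hfper : ∀ l, f (l + P) = f l := fun l => by
    simp only [hf, hring, hP, show l + (2 * (xr - xl).toNat + 2 * (yt - yb).toNat) + 1 =
      l + 1 + (2 * (xr - xl).toNat + 2 * (yt - yb).toNat) by ring, rectRing_add_period]
  -- a non-member within one period ahead
  have hex : ∃ m, ¬ (faceGraph R.carrier δ).Reachable p₀ (ring (k₀ + m)) := by
    refine ⟨(k₁ + P - k₀ % P) % P + P * 0, ?_⟩
    have e : ring (k₀ + ((k₁ + P - k₀ % P) % P + P * 0)) = ring k₁ := by
      rw [hring, ← rectRing_mod xl xr yb yt (k₀ + _), ← rectRing_mod xl xr yb yt k₁, ← hP]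
      congr 1
      rw [Nat.mul_zero, Nat.add_zero]
      have e1 : k₀ + (k₁ + P - k₀ % P) % P = (k₁ + P - k₀ % P) % P + k₀ % P + P * (k₀ / P) := by
        have := Nat.div_add_mod k₀ P; omega
      have e2 : (k₁ + P - k₀ % P) % P + k₀ % P = (k₁ + P - k₀ % P) % P + (k₀ % P) % P := by
        rw [Nat.mod_mod]
      rw [e1, Nat.add_mul_mod_self_left, e2, ← Nat.add_mod, show k₁ + P - k₀ % P + k₀ % P = k₁ + P by
        have := Nat.mod_lt k₀ hP0; omega, Nat.add_mod_right]
    rw [e]; exact hout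
  set m₀ := Nat.find hex with hm₀
  have hm₀spec : ¬ (faceGraph R.carrier δ).Reachable p₀ (ring (k₀ + m₀)) := Nat.find_spec hex
  have hmem : ∀ l < m₀, (faceGraph R.carrier δ).Reachable p₀ (ring (k₀ + l)) := fun l hl => by
    have := Nat.find_min hex (hm₀ ▸ hl)
    simpa using this
  have hm₀pos : 0 < m₀ := by
    by_contra h0'
    have : m₀ = 0 := by omega
    rw [this, add_zero] at hm₀spec
    exact hm₀spec hp
  have hm₀le : m₀ ≤ P := by
    have h1 : ¬ (faceGraph R.carrier δ).Reachable p₀ (ring (k₀ + (k₁ + P - k₀ % P) % P)) := by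
      have e : ring (k₀ + (k₁ + P - k₀ % P) % P) = ring k₁ := by
        rw [hring, ← rectRing_mod xl xr yb yt (k₀ + _), ← rectRing_mod xl xr yb yt k₁, ← hP]
        congr 1
        have e1 : k₀ + (k₁ + P - k₀ % P) % P = (k₁ + P - k₀ % P) % P + k₀ % P + P * (k₀ / P) := by
          have := Nat.div_add_mod k₀ P; omega
        have e2 : (k₁ + P - k₀ % P) % P + k₀ % P = (k₁ + P - k₀ % P) % P + (k₀ % P) % P := by
          rw [Nat.mod_mod]
        rw [e1, Nat.add_mul_mod_self_left, e2, ← Nat.add_mod, show k₁ + P - k₀ % P + k₀ % P = k₁ + P by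
          have := Nat.mod_lt k₀ hP0; omega, Nat.add_mod_right]
      rw [e]; exact hout
    have := Nat.find_min' hex h1
    have h2 : (k₁ + P - k₀ % P) % P < P := Nat.mod_lt _ hP0
    omega
  -- telescoping along the ring
  set g : ℕ → ℝ := fun l => facePot R.carrier δ h p₀ (ring (k₀ + l)) - c with hg
  have hstep : ∀ l, l + 1 < m₀ → g (l + 1) - g l = stepFlux (ecurH R.carrier δ h) (ecurV R.carrier δ h)
      (ring (k₀ + l)) (ring (k₀ + l + 1)) := by
    intro l hl
    have hr1 := hmem l (by omega)
    have hr2 := hmem (l + 1) hl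
    have hadj : (faceGraph R.carrier δ).Adj (ring (k₀ + l)) (ring (k₀ + l + 1)) := by
      refine faceGraph_adj_iff.2 ⟨by rw [hring]; exact rectRing_adj hx hy _, ?_, ?_⟩
      · obtain ⟨W⟩ := hr1; exact isInnerFace_of_mem_support' hp₀ W (Walk.end_mem_support _)
      · obtain ⟨W⟩ := hr2; exact isInnerFace_of_mem_support' hp₀ W (Walk.end_mem_support _)
    simp only [hg, show k₀ + (l + 1) = k₀ + l + 1 by ring]
    rw [← facePot_sub_facePot_of_adj R hδ hT hB hharm hp₀ hr1 hadj]
    ring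
  have htel : ∀ n, n < m₀ → |g 0 - g n| ≤ ∑ l ∈ Finset.range n, f (k₀ + l) := by
    intro n
    induction n with
    | zero => intro _; simp
    | succ n ih =>
      intro hn
      have h1 := ih (by omega)
      have h2 := hstep n hn
      rw [Finset.sum_range_succ]
      have h3 : |g n - g (n + 1)| = f (k₀ + n) := by
        rw [abs_sub_comm, h2]
      calc |g 0 - g (n + 1)| ≤ |g 0 - g n| + |g n - g (n + 1)| := abs_sub_le _ _ _
        _ ≤ _ := by rw [h3]; linarith
  -- the last member before the exit
  have hlast : |g (m₀ - 1)| ≤ 1 := by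
    have hr := hmem (m₀ - 1) (by omega)
    have hex' := hexit (k₀ + (m₀ - 1)) hr (by rw [show k₀ + (m₀ - 1) + 1 = k₀ + m₀ by omega]; exact hm₀spec)
    simp only [hg]
    rw [faceExitVal] at hex'
    have : facePot R.carrier δ h p₀ (ring (k₀ + (m₀ - 1))) - c =
        -stepFlux (ecurH R.carrier δ h) (ecurV R.carrier δ h) (ring (k₀ + (m₀ - 1))) (ring (k₀ + (m₀ - 1) + 1)) := by
      rw [hring] at hex' ⊢; linarith
    rw [this, abs_neg]
    exact abs_stepFlux_le_one' h01 _ _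
  have hmain := htel (m₀ - 1) (by omega)
  have hsum : ∑ l ∈ Finset.range (m₀ - 1), f (k₀ + l) ≤ ∑ l ∈ Finset.range P, f l := by
    rw [← sum_range_shift_of_periodic hfper k₀]
    exact Finset.sum_le_sum_of_subset_of_nonneg (Finset.range_mono (by omega)) fun l _ _ => abs_nonneg _
  have hg0 : g 0 = facePot R.carrier δ h p₀ (ring k₀) - c := by simp [hg]
  rw [← hg0]
  calc |g 0| ≤ |g 0 - g (m₀ - 1)| + |g (m₀ - 1)| := by
        have := abs_add_le (g 0 - g (m₀ - 1)) (g (m₀ - 1)); rwa [sub_add_cancel] at this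
    _ ≤ ∑ l ∈ Finset.range P, f l + 1 := add_le_add (hmain.trans hsum) hlast
    _ = _ := by rw [add_comm]


section GoodLines


/-- `ecur x y ^ 2` is the squared increment of the edge when `{x, y}` is an edge of `Ω_n`, and
zero otherwise. [folklore] -/
theorem ecur_sq_eq (h : Site 2 → ℝ) (x y : Site 2) [Decidable ((discreteDomainGraph Ω δ).Adj x y)] :
    ecur Ω δ h x y ^ 2 = if (discreteDomainGraph Ω δ).Adj x y then sqIncr h s(x, y) else 0 := by
  unfold ecur
  split_ifs <;> simp

open Classical in
/-- **Energy bound for a family of distinct edges.** The sum of `cur²` over the vertical edges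
`{a(t,i), a(t,i) + e₁}` indexed injectively by a finite set is at most the energy
`Σ_e (dh(e))²` of `h` on `Ω_n`. [folklore] -/
theorem sum_ecur_sq_le_energy {ι : Type*} (s : Finset ι) (a : ι → Site 2) (ha : Set.InjOn a s)
    (h : Site 2 → ℝ) (u : Site 2) (hu : u ≠ 0) (hEF : (discreteDomainGraph Ω δ).edgeSet.Finite) :
    ∑ t ∈ s, ecur Ω δ h (a t) (a t + u) ^ 2 ≤ ∑ e ∈ hEF.toFinset, sqIncr h e := by
  have step1 : ∑ t ∈ s, ecur Ω δ h (a t) (a t + u) ^ 2 =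
      ∑ t ∈ s.filter (fun t => (discreteDomainGraph Ω δ).Adj (a t) (a t + u)), sqIncr h s(a t, a t + u) := by
    rw [Finset.sum_filter]
    exact Finset.sum_congr rfl fun t _ => ecur_sq_eq h _ _
  rw [step1]
  have hinj : Set.InjOn (fun t => s(a t, a t + u)) (s.filter (fun t => (discreteDomainGraph Ω δ).Adj (a t) (a t + u))) := by
    intro t ht t' ht' he
    simp only [Finset.coe_filter, Set.mem_setOf_eq] at ht ht'
    have : a t = a t' := by
      rcases Sym2.eq_iff.1 he with ⟨h1, -⟩ | ⟨h1, h2⟩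
      · exact h1
      · -- `a t = a t' + u` and `a t + u = a t'` give `u + u = 0`
        have e : a t' + (u + u) = a t' + 0 := by rw [add_zero, ← add_assoc, ← h1]; exact h2
        have huu : u + u = 0 := add_left_cancel e
        exfalso; apply hu
        ext i
        have := congrFun huu i
        simp only [Pi.add_apply, Pi.zero_apply] at this
        simp only [Pi.zero_apply]
        omega
    exact ha ht.1 ht'.1 this
  rw [← Finset.sum_image hinj]
  refine Finset.sum_le_sum_of_subset_of_nonneg (fun e he => ?_) fun e _ _ => sqIncr_nonneg h e
  rw [Finset.mem_image] at he
  obtain ⟨t, ht, rfl⟩ := he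
  exact hEF.mem_toFinset.2 (Finset.mem_filter.1 ht).2

/-- **A good line.** Among `J + 1` parallel lines of `4J` steps each, one has total `|dh'|` at
most `2 √E`, `E` the energy (Cauchy–Schwarz and pigeonhole). Here for horizontal runs of squares
`(x₀ + i, y₀ + t)`, `i < 4J`, `t ≤ J`, whose steps cross the vertical edges from
`(x₀ + i + 1, y₀ + t)`. [folklore] -/
theorem exists_good_row' (hEF : (discreteDomainGraph Ω δ).edgeSet.Finite) (h : Site 2 → ℝ) {E : ℝ}
    (hE : ∑ e ∈ hEF.toFinset, sqIncr h e ≤ E) (x₀ y₀ : ℤ) {J : ℕ} (hJ : 1 ≤ J) :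
    ∃ t : ℕ, t ≤ J ∧ ∑ i ∈ Finset.range (4 * J),
      |stepFlux (ecurH Ω δ h) (ecurV Ω δ h) ![x₀ + i, y₀ + t] ![x₀ + i + 1, y₀ + t]| ≤ 2 * Real.sqrt E := by
  classical
  -- the step fluxes are currents of vertical edges
  have hsf : ∀ (i t : ℕ), stepFlux (ecurH Ω δ h) (ecurV Ω δ h) ![x₀ + i, y₀ + t] ![x₀ + i + 1, y₀ + t] =
      -ecur Ω δ h ![x₀ + i + 1, y₀ + t] (![x₀ + i + 1, y₀ + t] + Pi.single 1 1) := by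
    intro i t
    have hval : stepFlux (ecurH Ω δ h) (ecurV Ω δ h) ![x₀ + i, y₀ + t] ![x₀ + i + 1, y₀ + t] =
        -ecurV Ω δ h (![x₀ + i, y₀ + t] - Pi.single 1 1) := by
      unfold stepFlux; simp
    rw [hval, ecurV]
    have hv : (Pi.single 1 1 : Site 2) = ![0, 1] := by ext j; fin_cases j <;> simp
    have h1v : (1 : Site 2) = ![1, 1] := by ext j; fin_cases j <;> simp
    rw [hv, h1v]
    congr 2 <;> ext j <;> fin_cases j <;> simp
  set RS : ℕ → ℝ := fun t => ∑ i ∈ Finset.range (4 * J),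
    |stepFlux (ecurH Ω δ h) (ecurV Ω δ h) ![x₀ + i, y₀ + t] ![x₀ + i + 1, y₀ + t]| with hRS
  -- Cauchy–Schwarz on each row and the energy bound over all rows
  have hCS : ∀ t, RS t ^ 2 ≤ 4 * J * ∑ i ∈ Finset.range (4 * J),
      ecur Ω δ h ![x₀ + i + 1, y₀ + t] (![x₀ + i + 1, y₀ + t] + Pi.single 1 1) ^ 2 := by
    intro t
    have := sq_sum_le_card_mul_sum_sq (s := Finset.range (4 * J))
      (f := fun i => |stepFlux (ecurH Ω δ h) (ecurV Ω δ h) ![x₀ + i, y₀ + t] ![x₀ + i + 1, y₀ + t]|)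
    simp only [Finset.card_range, sq_abs] at this
    refine this.trans (le_of_eq ?_)
    push_cast
    congr 1
    exact Finset.sum_congr rfl fun i _ => by rw [hsf, neg_sq]
  have htot : ∑ t ∈ Finset.range (J + 1), ∑ i ∈ Finset.range (4 * J),
      ecur Ω δ h ![x₀ + i + 1, y₀ + t] (![x₀ + i + 1, y₀ + t] + Pi.single 1 1) ^ 2 ≤ E := by
    rw [← Finset.sum_product']
    refine (sum_ecur_sq_le_energy (Finset.range (J + 1) ×ˢ Finset.range (4 * J))
      (fun p : ℕ × ℕ => (![x₀ + p.2 + 1, y₀ + p.1] : Site 2)) ?_ h (Pi.single 1 1) (by simp) hEF).trans hE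
    intro p _ p' _ he
    have h0 := congrFun he 0
    have h1 := congrFun he 1
    simp at h0 h1
    ext <;> omega
  have hsum : ∑ t ∈ Finset.range (J + 1), RS t ^ 2 ≤ 4 * J * E := by
    calc ∑ t ∈ Finset.range (J + 1), RS t ^ 2
        ≤ ∑ t ∈ Finset.range (J + 1), 4 * J * ∑ i ∈ Finset.range (4 * J),
            ecur Ω δ h ![x₀ + i + 1, y₀ + t] (![x₀ + i + 1, y₀ + t] + Pi.single 1 1) ^ 2 :=
          Finset.sum_le_sum fun t _ => hCS t
      _ = 4 * J * ∑ t ∈ Finset.range (J + 1), ∑ i ∈ Finset.range (4 * J),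
            ecur Ω δ h ![x₀ + i + 1, y₀ + t] (![x₀ + i + 1, y₀ + t] + Pi.single 1 1) ^ 2 := by
          rw [Finset.mul_sum]
      _ ≤ 4 * J * E := by gcongr
  -- pigeonhole
  have hE0 : 0 ≤ E := le_trans (Finset.sum_nonneg fun e _ => sqIncr_nonneg h e) hE
  obtain ⟨t, ht, hle⟩ := Finset.exists_le_of_sum_le (s := Finset.range (J + 1)) (f := fun t => RS t ^ 2)
    (g := fun _ => 4 * E) (by simp) (by
      rw [Finset.sum_const, Finset.card_range, nsmul_eq_mul]
      push_cast
      have : (4 : ℝ) * J * E ≤ (J + 1) * (4 * E) := by nlinarith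
      exact hsum.trans this)
  refine ⟨t, by simpa [Nat.lt_succ_iff] using ht, ?_⟩
  have hRS0 : 0 ≤ RS t := Finset.sum_nonneg fun i _ => abs_nonneg _
  have : RS t ≤ Real.sqrt (4 * E) := Real.le_sqrt_of_sq_le hle
  rw [show (4 : ℝ) * E = 2 ^ 2 * E by norm_num, Real.sqrt_mul (by norm_num), Real.sqrt_sq (by norm_num)] at this
  exact this

/-- A good column (same, for vertical runs whose steps cross the horizontal edges from
`(x₀ + t + 1, y₀ + i + 1)`… more precisely the edges `{(x₀+t, y₀+i+1) + e₀… }`). [folklore] -/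
theorem exists_good_col' (hEF : (discreteDomainGraph Ω δ).edgeSet.Finite) (h : Site 2 → ℝ) {E : ℝ}
    (hE : ∑ e ∈ hEF.toFinset, sqIncr h e ≤ E) (x₀ y₀ : ℤ) {J : ℕ} (hJ : 1 ≤ J) :
    ∃ t : ℕ, t ≤ J ∧ ∑ i ∈ Finset.range (4 * J),
      |stepFlux (ecurH Ω δ h) (ecurV Ω δ h) ![x₀ + t, y₀ + i] ![x₀ + t, y₀ + i + 1]| ≤ 2 * Real.sqrt E := by
  classical
  have hsf : ∀ (i t : ℕ), stepFlux (ecurH Ω δ h) (ecurV Ω δ h) ![x₀ + t, y₀ + i] ![x₀ + t, y₀ + i + 1] =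
      ecur Ω δ h ![x₀ + t, y₀ + i + 1] (![x₀ + t, y₀ + i + 1] + Pi.single 0 1) := by
    intro i t
    have hval : stepFlux (ecurH Ω δ h) (ecurV Ω δ h) ![x₀ + t, y₀ + i] ![x₀ + t, y₀ + i + 1] =
        ecurH Ω δ h (![x₀ + t, y₀ + i] - Pi.single 0 1) := by
      unfold stepFlux; simp
    rw [hval, ecurH]
    have hv : (Pi.single 0 1 : Site 2) = ![1, 0] := by ext j; fin_cases j <;> simp
    have h1v : (1 : Site 2) = ![1, 1] := by ext j; fin_cases j <;> simp
    rw [hv, h1v]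
    congr 1 <;> ext j <;> fin_cases j <;> simp
  set RS : ℕ → ℝ := fun t => ∑ i ∈ Finset.range (4 * J),
    |stepFlux (ecurH Ω δ h) (ecurV Ω δ h) ![x₀ + t, y₀ + i] ![x₀ + t, y₀ + i + 1]| with hRS
  have hCS : ∀ t, RS t ^ 2 ≤ 4 * J * ∑ i ∈ Finset.range (4 * J),
      ecur Ω δ h ![x₀ + t, y₀ + i + 1] (![x₀ + t, y₀ + i + 1] + Pi.single 0 1) ^ 2 := by
    intro t
    have := sq_sum_le_card_mul_sum_sq (s := Finset.range (4 * J))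
      (f := fun i => |stepFlux (ecurH Ω δ h) (ecurV Ω δ h) ![x₀ + t, y₀ + i] ![x₀ + t, y₀ + i + 1]|)
    simp only [Finset.card_range, sq_abs] at this
    refine this.trans (le_of_eq ?_)
    push_cast
    congr 1
    exact Finset.sum_congr rfl fun i _ => by rw [hsf]
  have htot : ∑ t ∈ Finset.range (J + 1), ∑ i ∈ Finset.range (4 * J),
      ecur Ω δ h ![x₀ + t, y₀ + i + 1] (![x₀ + t, y₀ + i + 1] + Pi.single 0 1) ^ 2 ≤ E := by
    rw [← Finset.sum_product']
    refine (sum_ecur_sq_le_energy (Finset.range (J + 1) ×ˢ Finset.range (4 * J))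
      (fun p : ℕ × ℕ => (![x₀ + p.1, y₀ + p.2 + 1] : Site 2)) ?_ h (Pi.single 0 1) (by simp) hEF).trans hE
    intro p _ p' _ he
    have h0 := congrFun he 0
    have h1 := congrFun he 1
    simp at h0 h1
    ext <;> omega
  have hsum : ∑ t ∈ Finset.range (J + 1), RS t ^ 2 ≤ 4 * J * E := by
    calc ∑ t ∈ Finset.range (J + 1), RS t ^ 2
        ≤ ∑ t ∈ Finset.range (J + 1), 4 * J * ∑ i ∈ Finset.range (4 * J),
            ecur Ω δ h ![x₀ + t, y₀ + i + 1] (![x₀ + t, y₀ + i + 1] + Pi.single 0 1) ^ 2 :=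
          Finset.sum_le_sum fun t _ => hCS t
      _ = 4 * J * ∑ t ∈ Finset.range (J + 1), ∑ i ∈ Finset.range (4 * J),
            ecur Ω δ h ![x₀ + t, y₀ + i + 1] (![x₀ + t, y₀ + i + 1] + Pi.single 0 1) ^ 2 := by
          rw [Finset.mul_sum]
      _ ≤ 4 * J * E := by gcongr
  have hE0 : 0 ≤ E := le_trans (Finset.sum_nonneg fun e _ => sqIncr_nonneg h e) hE
  obtain ⟨t, ht, hle⟩ := Finset.exists_le_of_sum_le (s := Finset.range (J + 1)) (f := fun t => RS t ^ 2)
    (g := fun _ => 4 * E) (by simp) (by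
      rw [Finset.sum_const, Finset.card_range, nsmul_eq_mul]
      push_cast
      have : (4 : ℝ) * J * E ≤ (J + 1) * (4 * E) := by nlinarith
      exact hsum.trans this)
  refine ⟨t, by simpa [Nat.lt_succ_iff] using ht, ?_⟩
  have hRS0 : 0 ≤ RS t := Finset.sum_nonneg fun i _ => abs_nonneg _
  have : RS t ≤ Real.sqrt (4 * E) := Real.le_sqrt_of_sq_le hle
  rw [show (4 : ℝ) * E = 2 ^ 2 * E by norm_num, Real.sqrt_mul (by norm_num), Real.sqrt_sq (by norm_num)] at this
  exact this

end GoodLines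

end KirchhoffSlope

end Summit.CriticalPhenomena.CardyFormulaZ2.Theorems
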